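import Mathlib
import Summits.ValiantsHypothesis.ValiantsHypothesis.Theorems.LacunarySymmetroidMatrixDescartesMonotoneFlagExact

/-!
# `MatrixDescartes` (stmt-ValiantsHypothesis-18050) — FLAG FORM OF THE EXACT MONOTONE COUNT, IV: the ONE-SIDED PIVOT / FIRST-RUNG
# currency — `Z₊(mult) + dim W = ν(J) + π(J|W)` for `X^e J + Σ X^{dₖ} Pₖ` with PSD letters strictly on ONE side, `W = ⋂ ker Pₖ`

HONEST FRAMING.  Cell `pub-symmetroid`, seat `val-sym-mdr-p2` (gen 22); helper file `--supports` the crux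
`Theses.LacunarySymmetroid.MatrixDescartes` (OPEN), NO closure claim.  Restatement of `…MonotoneFlag` / `…MonotoneFlagExact` in the
currency of the line `Lift` (`firstRung_oneSided`, `OneSidedIndexRung`: pencils `X^e • J + Σₖ X^{d k} • P k`, `J` real symmetric,
`P k ⪰ 0`, arbitrary index types).  Nothing here bears on the crux in its window, `stub_twoSided`, `DoorA26` / `DoorA34`, registers, or
`VP ≠ VNP`.

* `pivotWord_eq_optionPencil` — the word is the lacunary pencil with letters `Option κ` (`none ↦ (e, J)`, `some k ↦ (d k, P k)`).
* **`oneSided_above_flag_bound`** — `e < d k` for all `k`, `det ≢ 0`, `B : ι × α` injective with `P k · B = 0` for all `k` ⇒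
  `Z₊(mult) + card α ≤ ν(J) + π(Bᵀ J B)`.  In particular (`card α = 0`) `Z₊(mult) ≤ ν(J)` — the one-sided index rung R0
  (`Z₊ ≤ q` for `J + WWᵀ ⪰ 0`, `W : ι × q`, since then `ν(J) ≤ q`) with multiplicity and sharpened by every direction killed by all
  letters on which `J` is `≤ 0`.
* **`oneSided_above_flag_exact`** — if moreover the range of `B` contains `⋂ₖ ker P k` (full basis): `Z₊(mult) + card α = ν(J) + π(BᵀJB)`,
  i.e. `Z₊(mult) = ν(J) − ν̄(J|_{⋂ ker Pₖ})` EXACTLY — the tree's `Inertia.firstRung_exact` / `oneSided_pencil_card_posRoots_multiset_eq`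
  WITHOUT any non-singularity hypothesis (`J`, the `P k` and every compression may be singular).
* **`oneSided_below_flag_bound` / `oneSided_below_flag_exact`** — the same two statements for `d k < e` (letters BELOW the pivot): by the
  sign symmetry `F ↦ −F` (`det(−F) = (−1)^m det F`, same roots) the pencil `X^e(−J) + Σ X^{d k}(−P k)` is monotone with NSD lower letters,
  and `π(−J) = ν(J)`, `ν(−BᵀJB) = π(BᵀJB)` give the SAME formula `Z₊(mult) + card α = ν(J) + π(BᵀJB)`.
So on BOTH one-sided sectors the count with multiplicity is the Gram-free, inverse-free quantity `ν(J) − ν̄(J|W)`, `W` the joint kernel of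
the PSD letters (ties `d k = e` are absorbed into `J` before applying the theorems).

[folklore] (Sylvester's law of inertia; Loewner monotonicity).  Axioms `propext`, `Classical.choice`, `Quot.sound`.  No definitions.
-/

-- layout Summits/ValiantsHypothesis/ValiantsHypothesis forces the duplicated namespace component
set_option linter.dupNamespace false

namespace Summit.ValiantsHypothesis.ValiantsHypothesis.Theorems.LacunarySymmetroidMatrixDescartes

open Polynomial Matrix Finset
open scoped BigOperators

namespace GramDual

section Pivot

variable {ι κ : Type} [Fintype ι] [DecidableEq ι] [Fintype κ] [DecidableEq κ]

omit [Fintype ι] [DecidableEq ι] [DecidableEq κ] in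
/-- The pivot word `X^e • J + Σₖ X^{d k} • P k` is the `Option κ`-indexed lacunary pencil. [folklore] -/
theorem pivotWord_eq_optionPencil (e : ℕ) (d : κ → ℕ) (J : Matrix ι ι ℝ) (P : κ → Matrix ι ι ℝ) :
    ((Polynomial.X : Polynomial ℝ) ^ e) • J.map Polynomial.C + ∑ k, ((Polynomial.X : Polynomial ℝ) ^ d k) • (P k).map Polynomial.C
      = ∑ o : Option κ, ((Polynomial.X : Polynomial ℝ) ^ (Option.elim o e d)) • (Option.elim o J P).map Polynomial.C := by
  rw [Fintype.sum_option]
  rfl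

/-- **One-sided above, flag bound**: `e < d k`, `det ≢ 0`, `B` injective killed by every letter ⇒ `Z₊(mult) + card α ≤ ν(J) + π(BᵀJB)`.
[folklore] -/
theorem oneSided_above_flag_bound (e : ℕ) (d : κ → ℕ) (J : Matrix ι ι ℝ) (P : κ → Matrix ι ι ℝ) (hJ : J.IsSymm)
    (hP : ∀ k, (P k).PosSemidef) (hd : ∀ k, e < d k)
    (hdet : Matrix.det (((Polynomial.X : Polynomial ℝ) ^ e) • J.map Polynomial.C
      + ∑ k, ((Polynomial.X : Polynomial ℝ) ^ d k) • (P k).map Polynomial.C) ≠ 0)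
    {α : Type} [Fintype α] [DecidableEq α] (B : Matrix ι α ℝ) (hB : ∀ k, P k * B = 0) (hBi : Function.Injective B.mulVec)
    (hC : (Bᵀ * J * B).IsHermitian) (hJh : J.IsHermitian) :
    Multiset.card ((Matrix.det (((Polynomial.X : Polynomial ℝ) ^ e) • J.map Polynomial.C
        + ∑ k, ((Polynomial.X : Polynomial ℝ) ^ d k) • (P k).map Polynomial.C)).roots.filter (fun t => 0 < t)) + Fintype.card α
      ≤ Fintype.card {j // hJh.eigenvalues j < 0} + Fintype.card {j // 0 < hC.eigenvalues j} := by
  classical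
  rw [pivotWord_eq_optionPencil] at hdet ⊢
  have hS : ∀ o : Option κ, (Option.elim o J P).IsSymm := fun o => by
    cases o with
    | none => exact hJ
    | some k => exact Inertia.isSymm_of_isHermitian (hP k).1
  have hup : ∀ o : Option κ, o ≠ none → (Option.elim o J P).PosSemidef ∧ Option.elim none e d < Option.elim o e d := fun o ho => by
    cases o with
    | none => exact absurd rfl ho
    | some k => exact ⟨hP k, hd k⟩
  have hBU : ∀ o : Option κ, Option.elim none e d < Option.elim o e d → Option.elim o J P * B = 0 := fun o ho => by
    cases o with
    | none => exact absurd ho (lt_irrefl _)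
    | some k => exact hB k
  exact monotone_pencil_flag_bound_oneSided (fun o : Option κ => Option.elim o e d) (fun o => Option.elim o J P) hS none hup hdet
    B hBU hBi hC hJh

/-- **One-sided above, EXACT**: with a full basis `B` of `⋂ₖ ker P k`, `Z₊(mult) + card α = ν(J) + π(BᵀJB)`. [folklore] -/
theorem oneSided_above_flag_exact (e : ℕ) (d : κ → ℕ) (J : Matrix ι ι ℝ) (P : κ → Matrix ι ι ℝ) (hJ : J.IsSymm)
    (hP : ∀ k, (P k).PosSemidef) (hd : ∀ k, e < d k)
    (hdet : Matrix.det (((Polynomial.X : Polynomial ℝ) ^ e) • J.map Polynomial.C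
      + ∑ k, ((Polynomial.X : Polynomial ℝ) ^ d k) • (P k).map Polynomial.C) ≠ 0)
    {α : Type} [Fintype α] [DecidableEq α] (B : Matrix ι α ℝ) (hB : ∀ k, P k * B = 0) (hBi : Function.Injective B.mulVec)
    (hBspan : ∀ v : ι → ℝ, (∀ k, P k *ᵥ v = 0) → ∃ c : α → ℝ, B *ᵥ c = v)
    (hC : (Bᵀ * J * B).IsHermitian) (hJh : J.IsHermitian) :
    Multiset.card ((Matrix.det (((Polynomial.X : Polynomial ℝ) ^ e) • J.map Polynomial.C
        + ∑ k, ((Polynomial.X : Polynomial ℝ) ^ d k) • (P k).map Polynomial.C)).roots.filter (fun t => 0 < t)) + Fintype.card α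
      = Fintype.card {j // hJh.eigenvalues j < 0} + Fintype.card {j // 0 < hC.eigenvalues j} := by
  classical
  rw [pivotWord_eq_optionPencil] at hdet ⊢
  have hS : ∀ o : Option κ, (Option.elim o J P).IsSymm := fun o => by
    cases o with
    | none => exact hJ
    | some k => exact Inertia.isSymm_of_isHermitian (hP k).1
  have hup : ∀ o : Option κ, o ≠ none → (Option.elim o J P).PosSemidef ∧ Option.elim none e d < Option.elim o e d := fun o ho => by
    cases o with
    | none => exact absurd rfl ho
    | some k => exact ⟨hP k, hd k⟩
  have hBU : ∀ o : Option κ, Option.elim none e d < Option.elim o e d → Option.elim o J P * B = 0 := fun o ho => by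
    cases o with
    | none => exact absurd ho (lt_irrefl _)
    | some k => exact hB k
  have hBUspan : ∀ v : ι → ℝ, (∀ o : Option κ, Option.elim none e d < Option.elim o e d → Option.elim o J P *ᵥ v = 0) →
      ∃ c : α → ℝ, B *ᵥ c = v := fun v hv => hBspan v fun k => hv (some k) (hd k)
  exact monotone_pencil_flag_exact_oneSided (fun o : Option κ => Option.elim o e d) (fun o => Option.elim o J P) hS none hup hdet
    B hBU hBi hBUspan hC hJh

omit [DecidableEq κ] in
/-- Sign symmetry: the roots of `det(X^e(−J) + Σ X^{d k}(−P k))` are those of `det(X^e J + Σ X^{d k} P k)`. [folklore] -/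
theorem roots_neg_pivotWord (e : ℕ) (d : κ → ℕ) (J : Matrix ι ι ℝ) (P : κ → Matrix ι ι ℝ) :
    (Matrix.det (((Polynomial.X : Polynomial ℝ) ^ e) • (-J).map Polynomial.C
        + ∑ k, ((Polynomial.X : Polynomial ℝ) ^ d k) • (-(P k)).map Polynomial.C)).roots
      = (Matrix.det (((Polynomial.X : Polynomial ℝ) ^ e) • J.map Polynomial.C
        + ∑ k, ((Polynomial.X : Polynomial ℝ) ^ d k) • (P k).map Polynomial.C)).roots := by
  have hneg : ((Polynomial.X : Polynomial ℝ) ^ e) • (-J).map Polynomial.C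
        + ∑ k, ((Polynomial.X : Polynomial ℝ) ^ d k) • (-(P k)).map Polynomial.C
      = -(((Polynomial.X : Polynomial ℝ) ^ e) • J.map Polynomial.C
        + ∑ k, ((Polynomial.X : Polynomial ℝ) ^ d k) • (P k).map Polynomial.C) := by
    rw [neg_add, ← Finset.sum_neg_distrib]
    congr 1
    · rw [Matrix.map_neg _ (map_neg Polynomial.C), smul_neg]
    · exact Finset.sum_congr rfl fun k _ => by rw [Matrix.map_neg _ (map_neg Polynomial.C), smul_neg]
  rw [hneg, Matrix.det_neg, show ((-1 : Polynomial ℝ) ^ Fintype.card ι) = Polynomial.C ((-1 : ℝ) ^ Fintype.card ι) by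
      rw [map_pow, map_neg, map_one],
    Polynomial.roots_C_mul _ (pow_ne_zero _ (neg_ne_zero.2 one_ne_zero))]

omit [DecidableEq κ] in
/-- Common data of the two «below» theorems: the negated word as an `Option κ`-pencil is monotone (lower letters NSD), `1` is a full basis
above (no upper letters), and `B` is killed by the lower letters. [folklore] -/
theorem below_setup (e : ℕ) (d : κ → ℕ) (J : Matrix ι ι ℝ) (P : κ → Matrix ι ι ℝ) (hJ : J.IsSymm)
    (hP : ∀ k, (P k).PosSemidef) (hd : ∀ k, d k < e)
    (hdet : Matrix.det (((Polynomial.X : Polynomial ℝ) ^ e) • J.map Polynomial.C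
      + ∑ k, ((Polynomial.X : Polynomial ℝ) ^ d k) • (P k).map Polynomial.C) ≠ 0)
    {α : Type} [Fintype α] (B : Matrix ι α ℝ) (hB : ∀ k, P k * B = 0) :
    (∀ o : Option κ, (Option.elim o (-J) (fun k => -(P k))).IsSymm)
    ∧ (∀ o : Option κ, o ≠ none →
      ((Option.elim o (-J) (fun k => -(P k))).PosSemidef ∧ Option.elim none e d < Option.elim o e d)
        ∨ ((-(Option.elim o (-J) (fun k => -(P k)))).PosSemidef ∧ Option.elim o e d < Option.elim none e d))
    ∧ Matrix.det (∑ o : Option κ, ((Polynomial.X : Polynomial ℝ) ^ (Option.elim o e d))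
      • (Option.elim o (-J) (fun k => -(P k))).map Polynomial.C) ≠ 0
    ∧ (∀ o : Option κ, Option.elim none e d < Option.elim o e d → Option.elim o (-J) (fun k => -(P k)) * (1 : Matrix ι ι ℝ) = 0)
    ∧ (∀ o : Option κ, Option.elim o e d < Option.elim none e d → Option.elim o (-J) (fun k => -(P k)) * B = 0) := by
  refine ⟨fun o => ?_, fun o ho => ?_, ?_, fun o ho => ?_, fun o ho => ?_⟩
  · cases o with
    | none => exact hJ.neg
    | some k => exact (Inertia.isSymm_of_isHermitian (hP k).1).neg
  · cases o with
    | none => exact absurd rfl ho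
    | some k => exact Or.inr ⟨by simpa only [Option.elim, neg_neg] using hP k, hd k⟩
  · have hre : (∑ o : Option κ, ((Polynomial.X : Polynomial ℝ) ^ (Option.elim o e d))
        • (Option.elim o (-J) (fun k => -(P k))).map Polynomial.C)
        = ((Polynomial.X : Polynomial ℝ) ^ e) • (-J).map Polynomial.C
          + ∑ k, ((Polynomial.X : Polynomial ℝ) ^ d k) • (-(P k)).map Polynomial.C :=
      (pivotWord_eq_optionPencil e d (-J) (fun k => -(P k))).symm
    rw [hre]
    intro h0
    apply hdet
    have hneg : ((Polynomial.X : Polynomial ℝ) ^ e) • (-J).map Polynomial.C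
          + ∑ k, ((Polynomial.X : Polynomial ℝ) ^ d k) • (-(P k)).map Polynomial.C
        = -(((Polynomial.X : Polynomial ℝ) ^ e) • J.map Polynomial.C
          + ∑ k, ((Polynomial.X : Polynomial ℝ) ^ d k) • (P k).map Polynomial.C) := by
      rw [neg_add, ← Finset.sum_neg_distrib]
      congr 1
      · rw [Matrix.map_neg _ (map_neg Polynomial.C), smul_neg]
      · exact Finset.sum_congr rfl fun k _ => by rw [Matrix.map_neg _ (map_neg Polynomial.C), smul_neg]
    rw [hneg, Matrix.det_neg] at h0
    rcases mul_eq_zero.1 h0 with h | h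
    · exact absurd h (pow_ne_zero _ (neg_ne_zero.2 one_ne_zero))
    · exact h
  · cases o with
    | none => exact absurd ho (lt_irrefl _)
    | some k => exact absurd (hd k) (lt_asymm ho)
  · cases o with
    | none => exact absurd ho (lt_irrefl _)
    | some k =>
      show -(P k) * B = 0
      rw [Matrix.neg_mul, hB k, neg_zero]

/-- **One-sided below, flag bound**: `d k < e`, `det ≢ 0`, `B` injective killed by every letter ⇒ `Z₊(mult) + card α ≤ ν(J) + π(BᵀJB)`
(the sign symmetry `F ↦ −F` turns the PSD lower letters into NSD ones). [folklore] -/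
theorem oneSided_below_flag_bound (e : ℕ) (d : κ → ℕ) (J : Matrix ι ι ℝ) (P : κ → Matrix ι ι ℝ) (hJ : J.IsSymm)
    (hP : ∀ k, (P k).PosSemidef) (hd : ∀ k, d k < e)
    (hdet : Matrix.det (((Polynomial.X : Polynomial ℝ) ^ e) • J.map Polynomial.C
      + ∑ k, ((Polynomial.X : Polynomial ℝ) ^ d k) • (P k).map Polynomial.C) ≠ 0)
    {α : Type} [Fintype α] [DecidableEq α] (B : Matrix ι α ℝ) (hB : ∀ k, P k * B = 0) (hBi : Function.Injective B.mulVec)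
    (hC : (Bᵀ * J * B).IsHermitian) (hJh : J.IsHermitian) :
    Multiset.card ((Matrix.det (((Polynomial.X : Polynomial ℝ) ^ e) • J.map Polynomial.C
        + ∑ k, ((Polynomial.X : Polynomial ℝ) ^ d k) • (P k).map Polynomial.C)).roots.filter (fun t => 0 < t)) + Fintype.card α
      ≤ Fintype.card {j // hJh.eigenvalues j < 0} + Fintype.card {j // 0 < hC.eigenvalues j} := by
  classical
  obtain ⟨hS, hmono, hdet', hBU, hBL⟩ := below_setup e d J P hJ hP hd hdet B hB
  have h1i : Function.Injective (1 : Matrix ι ι ℝ).mulVec := fun u v h => by simpa using h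
  have hCUo : ((1 : Matrix ι ι ℝ)ᵀ * Option.elim (none : Option κ) (-J) (fun k => -(P k)) * 1).IsHermitian := by
    show ((1 : Matrix ι ι ℝ)ᵀ * (-J) * 1).IsHermitian
    rw [Matrix.transpose_one, Matrix.one_mul, Matrix.mul_one]; exact hJh.neg
  have hCLo : (Bᵀ * Option.elim (none : Option κ) (-J) (fun k => -(P k)) * B).IsHermitian := by
    show (Bᵀ * (-J) * B).IsHermitian
    exact isHermitian_compression hJ.neg B
  have h := monotone_pencil_flag_bound (fun o : Option κ => Option.elim o e d) (fun o => Option.elim o (-J) (fun k => -(P k))) hS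
    none hmono hdet' 1 hBU h1i B hBL hBi hCUo hCLo
  have hJn : (-J).IsHermitian := hJh.neg
  have hJnn : (-(-J)).IsHermitian := hJn.neg
  have hCn : (-(Bᵀ * J * B)).IsHermitian := hC.neg
  have e1 : Fintype.card {j // 0 < hCUo.eigenvalues j} = Fintype.card {j // hJh.eigenvalues j < 0} := by
    rw [Inertia.posIndex_congr hCUo hJn (by rw [Matrix.transpose_one, Matrix.one_mul, Matrix.mul_one]; rfl)]
    have h1 := negIndex_neg_eq_posIndex hJn hJnn
    rw [Inertia.negIndex_congr hJnn hJh (neg_neg J)] at h1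
    exact h1.symm
  have e2 : Fintype.card {j // hCLo.eigenvalues j < 0} = Fintype.card {j // 0 < hC.eigenvalues j} := by
    rw [Inertia.negIndex_congr hCLo hCn (by
      show Bᵀ * (-J) * B = -(Bᵀ * J * B)
      rw [Matrix.mul_neg, Matrix.neg_mul])]
    exact negIndex_neg_eq_posIndex hC hCn
  have hroots : (Matrix.det (∑ o : Option κ, ((Polynomial.X : Polynomial ℝ) ^ (Option.elim o e d))
      • (Option.elim o (-J) (fun k => -(P k))).map Polynomial.C)).roots
      = (Matrix.det (((Polynomial.X : Polynomial ℝ) ^ e) • J.map Polynomial.C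
        + ∑ k, ((Polynomial.X : Polynomial ℝ) ^ d k) • (P k).map Polynomial.C)).roots := by
    rw [← pivotWord_eq_optionPencil]
    exact roots_neg_pivotWord e d J P
  rw [hroots, e1, e2] at h
  have hι : Fintype.card ι = Fintype.card ι := rfl
  omega

/-- **One-sided below, EXACT**: with a full basis `B` of `⋂ₖ ker P k`, `Z₊(mult) + card α = ν(J) + π(BᵀJB)`. [folklore] -/
theorem oneSided_below_flag_exact (e : ℕ) (d : κ → ℕ) (J : Matrix ι ι ℝ) (P : κ → Matrix ι ι ℝ) (hJ : J.IsSymm)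
    (hP : ∀ k, (P k).PosSemidef) (hd : ∀ k, d k < e)
    (hdet : Matrix.det (((Polynomial.X : Polynomial ℝ) ^ e) • J.map Polynomial.C
      + ∑ k, ((Polynomial.X : Polynomial ℝ) ^ d k) • (P k).map Polynomial.C) ≠ 0)
    {α : Type} [Fintype α] [DecidableEq α] (B : Matrix ι α ℝ) (hB : ∀ k, P k * B = 0) (hBi : Function.Injective B.mulVec)
    (hBspan : ∀ v : ι → ℝ, (∀ k, P k *ᵥ v = 0) → ∃ c : α → ℝ, B *ᵥ c = v)
    (hC : (Bᵀ * J * B).IsHermitian) (hJh : J.IsHermitian) :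
    Multiset.card ((Matrix.det (((Polynomial.X : Polynomial ℝ) ^ e) • J.map Polynomial.C
        + ∑ k, ((Polynomial.X : Polynomial ℝ) ^ d k) • (P k).map Polynomial.C)).roots.filter (fun t => 0 < t)) + Fintype.card α
      = Fintype.card {j // hJh.eigenvalues j < 0} + Fintype.card {j // 0 < hC.eigenvalues j} := by
  classical
  obtain ⟨hS, hmono, hdet', hBU, hBL⟩ := below_setup e d J P hJ hP hd hdet B hB
  have h1i : Function.Injective (1 : Matrix ι ι ℝ).mulVec := fun u v h => by simpa using h
  have hBUspan : ∀ v : ι → ℝ, (∀ o : Option κ, Option.elim none e d < Option.elim o e d →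
      Option.elim o (-J) (fun k => -(P k)) *ᵥ v = 0) → ∃ c : ι → ℝ, (1 : Matrix ι ι ℝ) *ᵥ c = v :=
    fun v _ => ⟨v, Matrix.one_mulVec v⟩
  have hBLspan : ∀ v : ι → ℝ, (∀ o : Option κ, Option.elim o e d < Option.elim none e d →
      Option.elim o (-J) (fun k => -(P k)) *ᵥ v = 0) → ∃ c : α → ℝ, B *ᵥ c = v := by
    intro v hv
    refine hBspan v fun k => ?_
    have h := hv (some k) (hd k)
    simp only [Option.elim, Matrix.neg_mulVec, neg_eq_zero] at h
    exact h
  have hCUo : ((1 : Matrix ι ι ℝ)ᵀ * Option.elim (none : Option κ) (-J) (fun k => -(P k)) * 1).IsHermitian := by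
    show ((1 : Matrix ι ι ℝ)ᵀ * (-J) * 1).IsHermitian
    rw [Matrix.transpose_one, Matrix.one_mul, Matrix.mul_one]; exact hJh.neg
  have hCLo : (Bᵀ * Option.elim (none : Option κ) (-J) (fun k => -(P k)) * B).IsHermitian := by
    show (Bᵀ * (-J) * B).IsHermitian
    exact isHermitian_compression hJ.neg B
  have h := monotone_pencil_flag_exact (fun o : Option κ => Option.elim o e d) (fun o => Option.elim o (-J) (fun k => -(P k))) hS
    none hmono hdet' 1 hBU h1i hBUspan B hBL hBi hBLspan hCUo hCLo
  have hJn : (-J).IsHermitian := hJh.neg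
  have hJnn : (-(-J)).IsHermitian := hJn.neg
  have hCn : (-(Bᵀ * J * B)).IsHermitian := hC.neg
  have e1 : Fintype.card {j // 0 < hCUo.eigenvalues j} = Fintype.card {j // hJh.eigenvalues j < 0} := by
    rw [Inertia.posIndex_congr hCUo hJn (by rw [Matrix.transpose_one, Matrix.one_mul, Matrix.mul_one]; rfl)]
    have h1 := negIndex_neg_eq_posIndex hJn hJnn
    rw [Inertia.negIndex_congr hJnn hJh (neg_neg J)] at h1
    exact h1.symm
  have e2 : Fintype.card {j // hCLo.eigenvalues j < 0} = Fintype.card {j // 0 < hC.eigenvalues j} := by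
    rw [Inertia.negIndex_congr hCLo hCn (by
      show Bᵀ * (-J) * B = -(Bᵀ * J * B)
      rw [Matrix.mul_neg, Matrix.neg_mul])]
    exact negIndex_neg_eq_posIndex hC hCn
  have hroots : (Matrix.det (∑ o : Option κ, ((Polynomial.X : Polynomial ℝ) ^ (Option.elim o e d))
      • (Option.elim o (-J) (fun k => -(P k))).map Polynomial.C)).roots
      = (Matrix.det (((Polynomial.X : Polynomial ℝ) ^ e) • J.map Polynomial.C
        + ∑ k, ((Polynomial.X : Polynomial ℝ) ^ d k) • (P k).map Polynomial.C)).roots := by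
    rw [← pivotWord_eq_optionPencil]
    exact roots_neg_pivotWord e d J P
  rw [hroots, e1, e2] at h
  have hι : Fintype.card ι = Fintype.card ι := rfl
  omega

end Pivot


end GramDual

end Summit.ValiantsHypothesis.ValiantsHypothesis.Theorems.LacunarySymmetroidMatrixDescartes
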